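/-
Copyright (c) 2026. All rights reserved.
Released under Apache 2.0 license as described in the file LICENSE.
Authors: abc-iut cell, prover seat abc-iut-L4-t10 (gen 14; row «COR510iv-HOL-MONO-CLOSE», abc-iut-L4-lead m174 (2)), over
abc-iut-L4-d3's `LogFrobeniusMonoTelecoreHolCompatible` (the typed sentence and the common super-diagram), abc-iut-f-101's
`LogFrobeniusMonoTelecoreOver` (`monoTeleOver`, `monoTelecore`), abc-iut-L4-t5's `LogFrobeniusAnTelecoreOverE` (`anOverE`,
`anTelecoreE`) and the generic toolkits (consumed BY NAME, nothing restated).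
-/
import Literature.AnabelianGeometry.AbsoluteAnabelian.LogFrobeniusMonoTelecoreHolCompatible
import Literature.AnabelianGeometry.AbsoluteAnabelian.LogFrobeniusMonoTelecoreOver
import Literature.AnabelianGeometry.AbsoluteAnabelian.LogFrobeniusMonoTelecoreObservablesShape
import Literature.AnabelianGeometry.AbsoluteAnabelian.LogFrobeniusAnTelecoreOverE
import Literature.AnabelianGeometry.AbsoluteAnabelian.DiagramOverTransport
import Literature.AnabelianGeometry.AbsoluteAnabelian.DiagramShiftInvarianceLifts
import Literature.AnabelianGeometry.AbsoluteAnabelian.DiagramPathEmbeddings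
import HarnessLib

/-!
# [AbsTopIII] Cor 5.10 (iv)(c): the common super-diagram of `D_{An•}` and `D_{An⊢}` LIES OVER the core `An⊢[𝒩⊢⊞]`;
# the holomorphic lifts (over `Th•[Z]`) are over `An⊢`; the two graph inclusions

S. Mochizuki, *Topics in absolute anabelian geometry III: global reconstruction algorithms* [MochizukiAbsTopIII2015];
manuscript `paper:url-5493eb38cbb7`, read on the page: Cor 5.10 (iv)(c) p. 148 l. 41–45 («… a contact structure `ℋ_{An⊢}` on
`𝔗_{An⊢}` that is compatible with the telecore and contact structures `𝔗_{An•}`, `ℋ_{An•}` of Corollary 5.5, (ii)»), Cor 5.5 (i)/(ii)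
p. 130 (the core `An•[𝒳]`, the telecore `𝔗_{An•}`), Cor 5.10 (iv)(a)/(b) p. 147 (`An⊢[𝒩⊢⊞]` «forms a core», `𝔗_{An⊢}`), Rmk 3.5.1 p. 78
(structure functors: «a core as a sort of 'constant portion' of the diagram that lies, in a consistent fashion, 'under the entire
diagram'»), Def 3.5 (ii) p. 75 («compatible» = contained in ONE family of homotopies).

PROOF-SIDE file 1/3 of the CLOSER of abc-iut-L4-d3's typed sentence `LogFrobeniusSetting.Cor510MonoContactHolCompatible` (row
«COR510iv-HOL-MONO-CLOSE»; nothing of the statement files is restated).  The point of the construction: abc-iut-L4-d3's common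
super-diagram `holMonoDiagram` — `D_{An⊢}` (abc-iut-f-101's `monoTeleDiagram`, base `D•⊢_{≤5} ∪ D•_{≤6}`, core vertex `An⊢`) extended by
the telecore vertex `An•[𝒳]` of `𝔗_{An•}` — LIES OVER THE CORE `An⊢[𝒩⊢⊞]` as a whole: abc-iut-f-101's structure functors
`monoTeleOver hN hψ` extend to the new vertex by `An•[𝒳] ↦ κ_{An•}⁻¹ ⋙ (ℰ• → ℰ⊢) ⋙ (ℰ⊢ ⥲ An⊢)` (`supOver`; the arrow `ℰ• → An•[𝒳]`
lies over by the unit of `κ_{An•}`, the telecore edges `φ_⋏` by abc-iut-L4-t5's `φ_{An•} ⋙ proj ≅ κ_{An•}⁻¹`).  Then: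

* along abc-iut-L4-d3's base inclusion `embMonoSuper` the super-diagram restricts to `D_{An⊢}` with abc-iut-f-101's structure
  functors ON THE NOSE (`monoTelecoreDiagram_eq_comapAlong`, `monoTeleOver_eq_comapAlong`: `rfl`), so abc-iut-L4-t5's lifts at the
  core `An⊢` of `D_{An⊢}` are the lifts of the super-diagram (`lift_embMono_heq`, abc-iut-w6-d023's `lift_comapAlong`);
* `embHolSuper` is a graph EMBEDDING and a SIEVE (`graphEmbedding_embHol`, `isSieve_embHol`: nothing enters `D•_{≤5} ∪ {An•[𝒳]}`
  from the mono-analytic side), the super-diagram restricts along it to abc-iut-L4-t3's `D_{An•}` (`anDiagram_eq_comapAlong`), and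
  abc-iut-L4-t5's PLAIN structure functors of `D_{An•}` over `Th•[Z]` read on that presentation (`holOverE`) ARE `anOverE`
  (`anOverE_heq_holOverE`) — file 2 (`LogFrobeniusHolMonoSuperTransfer`) compares them with `supOver`;
* `isEmpty_path_monoCore_holCore` — no path of the super-diagram runs from `An⊢` back to `An•[𝒳]` (`InHolRegion`).

HONEST FRAMING: OUR kernel constructions over abc-iut-L4-t3's typed §5 interface (`hN`, `hψ` are the printed data (a) Def 5.6 (iv)
rows-4→5 mono-analyticization homotopies and (c) «`ψ^{An⊢⊞}_{w,ν}` lies over `ℰ⊢`», hypotheses exactly as in abc-iut-f-101's files);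
refereed pre-IUT material; nothing here bears on [IUTchIII] Cor. 3.12; no side taken; typed ≠ proved.
-/

set_option autoImplicit false

universe u

open CategoryTheory Quiver

namespace Literature.AnabelianGeometry.AbsoluteAnabelian

namespace LogFrobeniusSetting

open DiagramOfCategories

variable {Vmod : Type u} {isArc : Vmod → Bool} (L : LogFrobeniusSetting Vmod isArc)

/-! ## The common super-diagram at the printed telecore edges -/

/-- The shape of the common super-diagram of `D_{An•}` and `D_{An⊢}` at the PRINTED telecore edges (`φ_⋏ = φ_{An•}`, abc-iut-L4-t3's
`TelecoreIdx`; `φ^{An⊢⊞}_{w,ν}`, abc-iut-L4-t3's `MonoTelecoreIdx`) — abc-iut-L4-d3's `holMonoShape`.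
[cite: MochizukiAbsTopIII2015, Cor 5.10 (iv)(c) p. 148] -/
abbrev supShape (Vmod : Type u) (isArc : Vmod → Bool) : ExtShape.{u} ((monoTeleShape Vmod isArc).Vertex) :=
  holMonoShape (Vmod := Vmod) (isArc := isArc) anJ monoJ

/-- The common super-diagram as a diagram of categories (abc-iut-L4-d3's `holMonoDiagram` at the printed telecore functors: copies of
`φ_{An•}` out of `An•[𝒳]`, the `ψ^{An⊢⊞}_{w,ν}` out of `An⊢[𝒩⊢⊞]`). [cite: MochizukiAbsTopIII2015, Cor 5.10 (iv)(c) p. 148] -/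
abbrev supDiagram : DiagramOfCategories.{u, u + 1, u} (supShape Vmod isArc).Vertex :=
  L.holMonoDiagram anJ monoJ L.anTel L.monoTelMap

/-- The telecore vertex `An•[𝒳]` of `𝔗_{An•}` in the super-diagram (the new vertex).
[cite: MochizukiAbsTopIII2015, Cor 5.5 (ii) p. 130] -/
abbrev holCore (Vmod : Type u) (isArc : Vmod → Bool) : (supShape Vmod isArc).Vertex := ExtVertex.obs

/-- The core vertex `An⊢[𝒩⊢⊞]` of `𝔗_{An⊢}` in the super-diagram (a base vertex).
[cite: MochizukiAbsTopIII2015, Cor 5.10 (iv)(a) p. 147] -/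
abbrev monoCore (Vmod : Type u) (isArc : Vmod → Bool) : (supShape Vmod isArc).Vertex :=
  ExtVertex.base (monoTeleShape Vmod isArc).obs

/-- The base inclusion `Γ⃗_{D_{An⊢}} ↪ Γ⃗_{super}` (abc-iut-L4-d3's `embMonoSuper` at the printed edges).
[cite: MochizukiAbsTopIII2015, Cor 5.10 (iv)(c) p. 148] -/
abbrev embMono (Vmod : Type u) (isArc : Vmod → Bool) :
    (monoTeleShape Vmod isArc).Vertex ⥤q (supShape Vmod isArc).Vertex :=
  embMonoSuper (Vmod := Vmod) (isArc := isArc) anJ monoJ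

/-- The inclusion `Γ⃗_{D_{An•}} ↪ Γ⃗_{super}` (abc-iut-L4-d3's `embHolSuper` at the printed edges).
[cite: MochizukiAbsTopIII2015, Cor 5.10 (iv)(c) p. 148] -/
abbrev embHol (Vmod : Type u) (isArc : Vmod → Bool) :
    (anShape (Vmod := Vmod) (isArc := isArc)).Vertex ⥤q (supShape Vmod isArc).Vertex :=
  embHolSuper (Vmod := Vmod) (isArc := isArc) anJ monoJ

/-! ## The super-diagram lies over the core `An⊢[𝒩⊢⊞]` -/

section Over

variable (hN : ∀ v : Vmod, L.monoN v ⋙ L.toEmono v ≅ L.toE v ⋙ L.monoAn)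
  (hψ : ∀ (w : Vmod) (j : {ν : LogVertex (isArc w) // ν.IsCross}),
    L.ψAnMono w j ⋙ L.forgetMono w ⋙ L.toEmono w ≅ L.κAnMono.inverse)

/-- The telecore edges `φ_⋏ = φ_{An•} : An•[𝒳] → 𝒳_⋏` lie over the core `An⊢[𝒩⊢⊞]`: `φ_{An•} ⋙ (𝒳 → ℰ• → ℰ⊢ ⥲ An⊢) ≅
κ_{An•}⁻¹ ⋙ (ℰ• → ℰ⊢ ⥲ An⊢)` by abc-iut-L4-t5's `φAnOverE : φ_{An•} ⋙ proj ≅ κ_{An•}⁻¹`.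
[cite: MochizukiAbsTopIII2015, Cor 5.5 (ii) p. 130] -/
noncomputable def supTelIso : ∀ (a : DSub (monoBase (Vmod := Vmod) (isArc := isArc) 6))
    (j : HolIdxLift (Vmod := Vmod) (isArc := isArc) anJ a),
    L.telecoreFun a.1 j.2 ⋙ L.coreStructFunctor a.1 ≅ L.coreStructFunctor .an
  | ⟨.row1 _, _⟩, _ => (Functor.associator _ _ _).symm ≪≫
      Functor.isoWhiskerRight ((Functor.associator _ _ _).symm ≪≫ Functor.isoWhiskerRight L.φAnOverE L.monoAn) L.κAnMono.functor
  | ⟨.core, _⟩, _ => (Functor.associator _ _ _).symm ≪≫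
      Functor.isoWhiskerRight ((Functor.associator _ _ _).symm ≪≫ Functor.isoWhiskerRight L.φAnOverE L.monoAn) L.κAnMono.functor
  | ⟨.nplus _, _⟩, j => PEmpty.elim j.2
  | ⟨.nv _, _⟩, j => PEmpty.elim j.2
  | ⟨.e5, _⟩, j => PEmpty.elim j.2
  | ⟨.an, _⟩, j => PEmpty.elim j.2
  | ⟨.e7, _⟩, j => PEmpty.elim j.2
  | ⟨.nmonoPlus _, _⟩, j => PEmpty.elim j.2
  | ⟨.nmono _, _⟩, j => PEmpty.elim j.2
  | ⟨.emono5, _⟩, j => PEmpty.elim j.2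
  | ⟨.anMono, _⟩, j => PEmpty.elim j.2
  | ⟨.emono7, _⟩, j => PEmpty.elim j.2

/-- **The super-diagram lies over the core `An⊢[𝒩⊢⊞]`**: abc-iut-f-101's `monoTeleOver hN hψ` on `D_{An⊢}` extended to the telecore
vertex `An•[𝒳]` by the structure functor `κ_{An•}⁻¹ ⋙ (ℰ• → ℰ⊢) ⋙ (ℰ⊢ ⥲ An⊢)` (abc-iut-f-101's `coreStructFunctor .an`); the observation
arrow `ℰ• → An•[𝒳]` lies over by the unit of `κ_{An•}` (abc-iut-f-101's `monoOver`, arrow `κAn`), the telecore edges by `supTelIso`.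
[cite: MochizukiAbsTopIII2015, Remark 3.5.1 p.78] -/
noncomputable def supOver : (L.supDiagram).OverData L.AnMono :=
  OverData.extendOver (D := L.monoTelecoreDiagram monoJ L.monoTelMap) _ (L.monoTeleOver hN hψ) (L.coreStructFunctor .an)
    (fun a i => match a, i with
      | ExtVertex.base a, i => (L.monoOver hN).μ (show a ⟶ (⟨DVertex.an, monoBase_six_an⟩ : DSub (monoBase 6)) from i)
      | ExtVertex.obs, i => PEmpty.elim i)
    (fun a j => match a, j with
      | ExtVertex.base a, j => L.supTelIso a j
      | ExtVertex.obs, j => PEmpty.elim j)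

/-- At a vertex of `D_{An⊢}` the structure functor of the super-diagram is abc-iut-f-101's.
[cite: MochizukiAbsTopIII2015, Remark 3.5.1 p.78] -/
@[simp] theorem supOver_N_base (v : (monoTeleShape Vmod isArc).Vertex) :
    (L.supOver hN hψ).N (ExtVertex.base v) = (L.monoTeleOver hN hψ).N v := rfl

/-- At the telecore vertex `An•[𝒳]` the structure functor is `κ_{An•}⁻¹ ⋙ (ℰ• → ℰ⊢) ⋙ (ℰ⊢ ⥲ An⊢)`.
[cite: MochizukiAbsTopIII2015, Remark 3.5.1 p.78] -/
@[simp] theorem supOver_N_holCore : (L.supOver hN hψ).N (holCore Vmod isArc) = L.coreStructFunctor .an := rfl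

/-- At the core vertex `An⊢[𝒩⊢⊞]` the structure functor is the identity, in particular fully faithful.
[cite: MochizukiAbsTopIII2015, Definition 3.5 (iii) p.75] -/
def supOver_ff_monoCore : ((L.supOver hN hψ).N (monoCore Vmod isArc)).FullyFaithful := Functor.FullyFaithful.id _

end Over

/-! ## Along the base inclusion `Γ⃗_{D_{An⊢}} ↪ Γ⃗_{super}`: `D_{An⊢}` with abc-iut-f-101's structure functors, on the nose -/

section Mono

variable (hN : ∀ v : Vmod, L.monoN v ⋙ L.toEmono v ≅ L.toE v ⋙ L.monoAn)
  (hψ : ∀ (w : Vmod) (j : {ν : LogVertex (isArc w) // ν.IsCross}),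
    L.ψAnMono w j ⋙ L.forgetMono w ⋙ L.toEmono w ≅ L.κAnMono.inverse)

/-- `D_{An⊢}` IS the super-diagram pulled back along the base inclusion (abc-iut-L4-t5's `comapAlong`; definitionally).
[cite: MochizukiAbsTopIII2015, Definition 3.5 (i) p.74] -/
theorem monoTelecoreDiagram_eq_comapAlong :
    L.monoTelecoreDiagram monoJ L.monoTelMap = L.supDiagram.comapAlong (embMono Vmod isArc) := rfl

/-- … with abc-iut-f-101's structure functors over the core (definitionally). [cite: MochizukiAbsTopIII2015, Remark 3.5.1 p.78] -/
theorem monoTeleOver_eq_comapAlong :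
    L.monoTeleOver hN hψ = (L.supOver hN hψ).comapAlong (embMono Vmod isArc) := rfl

/-- **abc-iut-L4-t5's lifts at the core `An⊢` of `D_{An⊢}` are the lifts of the super-diagram at `An⊢`** (same structure functors;
abc-iut-w6-d023's `lift_comapAlong`). [cite: MochizukiAbsTopIII2015, Remark 3.5.1 p.78] -/
theorem lift_embMono_heq [Nonempty Vmod] {a : (monoTeleShape Vmod isArc).Vertex} (p q : Path a (monoTeleShape Vmod isArc).obs) :
    HEq ((L.monoTeleOver hN hψ).lift (L.monoTeleOver_ff hN hψ _ rfl) p q)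
      ((L.supOver hN hψ).lift (L.supOver_ff_monoCore hN hψ) ((embMono Vmod isArc).mapPath p) ((embMono Vmod isArc).mapPath q)) :=
  OverData.lift_comapAlong (L.supOver hN hψ) (embMono Vmod isArc) (L.supOver_ff_monoCore hN hψ) p q

end Mono

/-! ## Along `Γ⃗_{D_{An•}} ↪ Γ⃗_{super}`: an embedding and a sieve; `D_{An•}`; abc-iut-L4-t5's structure functors over `Th•[Z]` -/

section Hol

/-- `embHolSuper` is injective on vertices. [cite: MochizukiAbsTopIII2015, Section 0 p.26] -/
theorem embHol_obj_injective : Function.Injective (embHol Vmod isArc).obj := by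
  rintro (⟨a, ha⟩ | _) (⟨b, hb⟩ | _) h
  · cases h; rfl
  · cases h
  · cases h
  · rfl

/-- `embHolSuper` is injective on arrows. [cite: MochizukiAbsTopIII2015, Section 0 p.26] -/
theorem embHol_map_injective {a b : (anShape (Vmod := Vmod) (isArc := isArc)).Vertex} :
    Function.Injective ((embHol Vmod isArc).map : (a ⟶ b) → _) := by
  rcases a with a | _ <;> rcases b with b | _
  · intro e e' h; exact h
  · intro e e' h; exact h
  · intro e e' h
    exact eq_of_heq (PSigma.mk.inj h).2
  · intro e; exact PEmpty.elim e

/-- `embHolSuper` is an EMBEDDING of oriented graphs (abc-iut-f-101's `GraphEmbedding`). [cite: MochizukiAbsTopIII2015, Section 0 p.26] -/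
theorem graphEmbedding_embHol : GraphEmbedding (embHol Vmod isArc) :=
  ⟨embHol_obj_injective, fun {_ _} => embHol_map_injective⟩

/-- `embHolSuper` is a SIEVE (abc-iut-f-101's `IsSieve`): every arrow of the super-diagram INTO `D•_{≤5} ∪ {An•[𝒳]}` comes from
`D_{An•}` — nothing returns from the mono-analytic side to the holomorphic rows. [cite: MochizukiAbsTopIII2015, Section 0 p.26] -/
theorem isSieve_embHol : IsSieve (embHol Vmod isArc) := by
  intro c b' e
  rcases b' with ⟨bv, hb⟩ | _
  · -- into a vertex of `D•_{≤5}`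
    rcases c with (⟨zv, hz⟩ | _) | _
    · change DEdge isArc zv bv at e
      cases e with
      | log n => exact ⟨(anShape (Vmod := Vmod) (isArc := isArc)).base ⟨.row1 (n + 1), row1_mem_five (n + 1)⟩,
          (show (anShape (Vmod := Vmod) (isArc := isArc)).base ⟨.row1 (n + 1), row1_mem_five (n + 1)⟩ ⟶
            (anShape (Vmod := Vmod) (isArc := isArc)).base ⟨.row1 n, hb⟩ from DEdge.log n), rfl, HEq.rfl⟩
      | toCore n => exact ⟨(anShape (Vmod := Vmod) (isArc := isArc)).base ⟨.row1 n, row1_mem_five n⟩,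
          (show (anShape (Vmod := Vmod) (isArc := isArc)).base ⟨.row1 n, row1_mem_five n⟩ ⟶
            (anShape (Vmod := Vmod) (isArc := isArc)).base ⟨.core, hb⟩ from DEdge.toCore n), rfl, HEq.rfl⟩
      | lam v ν hν => exact ⟨(anShape (Vmod := Vmod) (isArc := isArc)).base ⟨.core, core_mem_five⟩,
          (show (anShape (Vmod := Vmod) (isArc := isArc)).base ⟨.core, core_mem_five⟩ ⟶
            (anShape (Vmod := Vmod) (isArc := isArc)).base ⟨.nplus v, hb⟩ from DEdge.lam v ν hν), rfl, HEq.rfl⟩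
      | forget v => exact ⟨(anShape (Vmod := Vmod) (isArc := isArc)).base ⟨.nplus v, nplus_mem_five v⟩,
          (show (anShape (Vmod := Vmod) (isArc := isArc)).base ⟨.nplus v, nplus_mem_five v⟩ ⟶
            (anShape (Vmod := Vmod) (isArc := isArc)).base ⟨.nv v, hb⟩ from DEdge.forget v), rfl, HEq.rfl⟩
      | toE v => exact ⟨(anShape (Vmod := Vmod) (isArc := isArc)).base ⟨.nv v, nv_mem_five v⟩,
          (show (anShape (Vmod := Vmod) (isArc := isArc)).base ⟨.nv v, nv_mem_five v⟩ ⟶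
            (anShape (Vmod := Vmod) (isArc := isArc)).base ⟨.e5, hb⟩ from DEdge.toE v), rfl, HEq.rfl⟩
      | κAn => exact absurd hb.2 (by change ¬ (6 ≤ 5); decide)
      | anToE => exact absurd hb.2 (by change ¬ (7 ≤ 5); decide)
      | monoNplus v => exact hb.1.elim
      | monoN v => exact hb.1.elim
      | monoE5 => exact hb.1.elim
      | monoAn => exact hb.1.elim
      | monoE7 => exact hb.1.elim
      | forgetMono w => exact hb.1.elim
      | toEmono w => exact hb.1.elim
      | κAnMono => exact hb.1.elim
      | anMonoToE => exact hb.1.elim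
    · exact ((monoJ_isEmpty_of_isHolomorphic ⟨bv, monoBase_six_of_inFive hb⟩ hb.1).false e).elim
    · -- a telecore edge `φ_⋏` out of `An•[𝒳]`
      obtain ⟨h, j⟩ := e
      exact ⟨(anShape (Vmod := Vmod) (isArc := isArc)).obs, j, rfl, HEq.rfl⟩
  · -- into the telecore vertex `An•[𝒳]`: only the copy of `κ_{An•}` from `ℰ•`
    rcases c with (⟨zv, hz⟩ | _) | _
    · change DEdge isArc zv .an at e
      cases e with
      | κAn => exact ⟨(anShape (Vmod := Vmod) (isArc := isArc)).base ⟨.e5, e5_mem_five⟩,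
          (show (anShape (Vmod := Vmod) (isArc := isArc)).base ⟨.e5, e5_mem_five⟩ ⟶ (anShape (Vmod := Vmod) (isArc := isArc)).obs
            from DEdge.κAn), rfl, HEq.rfl⟩
    · exact PEmpty.elim e
    · exact PEmpty.elim e

/-- abc-iut-L4-t3's `D_{An•}` (at the printed telecore edges) IS the super-diagram pulled back along `embHolSuper`.
[cite: MochizukiAbsTopIII2015, Definition 3.5 (i) p.74] -/
theorem anDiagram_eq_comapAlong : L.anDiagram = L.supDiagram.comapAlong (embHol Vmod isArc) := by
  refine DiagramOfCategories.eq_comapAlong _ _ (fun a => ?_) (fun a => ?_) (fun e => ?_)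
  · cases a <;> rfl
  · cases a <;> exact HEq.rfl
  · rename_i a b
    rcases a with a | _ <;> rcases b with b | _
    · exact HEq.rfl
    · exact HEq.rfl
    · exact HEq.rfl
    · exact PEmpty.elim e

/-- abc-iut-L4-t5's PLAIN structure functors of `D_{An•}` over `Th•[Z]` (`anOverE`: `𝒳_⋎, □ ↦ proj`, `𝒩⊞_v ↦ 𝒩⊞_v → 𝒩_v → ℰ•`,
`𝒩_v ↦ 𝒩_v → ℰ•`, `ℰ• ↦ 𝟭`, `An•[𝒳] ↦ κ_{An•}⁻¹`) read on the pulled-back presentation. [cite: MochizukiAbsTopIII2015, Remark 3.5.1 p.78] -/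
noncomputable def holOverE : (L.supDiagram.comapAlong (embHol Vmod isArc)).OverData L.E where
  N x := match x with
    | ExtVertex.base a => L.baseN a.1 a.2
    | ExtVertex.obs => L.κAn.inverse
  μ {x y} e := match x, y, e with
    | ExtVertex.base _, ExtVertex.base _, e => L.baseμ e _ _
    | ExtVertex.base a, ExtVertex.obs, i => L.anObsIso a i
    | ExtVertex.obs, ExtVertex.base b, j => L.anTelIso b j
    | ExtVertex.obs, ExtVertex.obs, e => PEmpty.elim e

/-- They ARE abc-iut-L4-t5's `anOverE`, heterogeneously along `anDiagram_eq_comapAlong`. [cite: MochizukiAbsTopIII2015, Remark 3.5.1 p.78] -/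
theorem anOverE_heq_holOverE : HEq L.anOverE L.holOverE := by
  refine OverData.heq_of_eq L.anDiagram_eq_comapAlong (fun a => ?_) (fun a b e => ?_)
  · cases a <;> exact HEq.rfl
  · rcases a with a | _ <;> rcases b with b | _
    · exact HEq.rfl
    · exact HEq.rfl
    · exact HEq.rfl
    · exact PEmpty.elim e

/-- The structure functor at `An•[𝒳]` (`κ_{An•}⁻¹`) is fully faithful. [cite: MochizukiAbsTopIII2015, Cor 5.5 (i) p. 130] -/
noncomputable def holOverE_ff_obs : (L.holOverE.N (anShape (Vmod := Vmod) (isArc := isArc)).obs).FullyFaithful :=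
  L.κAn.fullyFaithfulInverse

end Hol

/-! ## No path of the super-diagram returns from the mono-analytic core to `An•[𝒳]` -/

section Reach

/-- The vertices from which the telecore vertex `An•[𝒳]` can be reached: `An•[𝒳]` itself and `D•_{≤5}` (the image of `embHolSuper`).
[cite: MochizukiAbsTopIII2015, Cor 5.5 (ii) p. 130] -/
def InHolRegion : (supShape Vmod isArc).Vertex → Prop
  | ExtVertex.obs => True
  | ExtVertex.base ExtVertex.obs => False
  | ExtVertex.base (ExtVertex.base x) => x.1.InFirstRows 5

/-- An arrow into the holomorphic region starts in the holomorphic region (nothing enters `D•_{≤5} ∪ {An•[𝒳]}` from the mono-analytic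
side or from row 6). [cite: MochizukiAbsTopIII2015, Cor 5.10 p. 146] -/
theorem inHolRegion_of_hom {u v : (supShape Vmod isArc).Vertex} (e : u ⟶ v) (hv : InHolRegion v) : InHolRegion u := by
  rcases u with (⟨zv, hz⟩ | _) | _ <;> rcases v with (⟨xv, hx⟩ | _) | _
  · change DEdge isArc zv xv at e
    change xv.InFirstRows 5 at hv
    change zv.InFirstRows 5
    cases e with
    | log n => exact row1_mem_five (n + 1)
    | toCore n => exact row1_mem_five n
    | lam v ν hν => exact core_mem_five
    | forget v => exact nplus_mem_five v
    | toE v => exact nv_mem_five v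
    | κAn => exact absurd hv.2 (by change ¬ (6 ≤ 5); decide)
    | anToE => exact absurd hv.2 (by change ¬ (7 ≤ 5); decide)
    | monoNplus v => exact hv.1.elim
    | monoN v => exact hv.1.elim
    | monoE5 => exact hv.1.elim
    | monoAn => exact hv.1.elim
    | monoE7 => exact hv.1.elim
    | forgetMono w => exact hv.1.elim
    | toEmono w => exact hv.1.elim
    | κAnMono => exact hv.1.elim
    | anMonoToE => exact hv.1.elim
  · exact hv.elim
  · change DEdge isArc zv .an at e
    change zv.InFirstRows 5
    cases e with
    | κAn => exact e5_mem_five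
  · exact ((monoJ_isEmpty_of_isHolomorphic ⟨xv, monoBase_six_of_inFive hv⟩ hv.1).false e).elim
  · exact hv.elim
  · exact PEmpty.elim e
  · trivial
  · trivial
  · trivial

/-- A path into the holomorphic region starts in the holomorphic region. [cite: MochizukiAbsTopIII2015, Cor 5.10 p. 146] -/
theorem inHolRegion_of_path {u v : (supShape Vmod isArc).Vertex} (p : Path u v) (hv : InHolRegion v) : InHolRegion u := by
  induction p with
  | nil => exact hv
  | cons p e ih => exact ih (inHolRegion_of_hom e hv)

/-- **No path of the super-diagram runs from the core `An⊢[𝒩⊢⊞]` to `An•[𝒳]`** (the mono-analyticisation arrows go one way).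
[cite: MochizukiAbsTopIII2015, Cor 5.10 p. 146] -/
theorem isEmpty_path_monoCore_holCore : IsEmpty (Path (monoCore Vmod isArc) (holCore Vmod isArc)) :=
  ⟨fun p => inHolRegion_of_path p trivial⟩

/-- More generally: no path from a vertex of the telecore graph `Γ⃗_{D_{An⊢}}` outside `D•_{≤5}` reaches `An•[𝒳]`.
[cite: MochizukiAbsTopIII2015, Cor 5.10 p. 146] -/
theorem inHolRegion_of_path_holCore {u : (supShape Vmod isArc).Vertex} (p : Path u (holCore Vmod isArc)) : InHolRegion u :=
  inHolRegion_of_path p trivial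

end Reach


end LogFrobeniusSetting

end Literature.AnabelianGeometry.AbsoluteAnabelian
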